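import Summits.BirchSwinnertonDyer.BirchSwinnertonDyer.Theses.ClassRecordThree
import Summits.BirchSwinnertonDyer.BirchSwinnertonDyer.Theses.KolyvaginRoadThree
import Summits.BirchSwinnertonDyer.BirchSwinnertonDyer.Theorems.CartanOnePlaceDegreeLawAtThree.Negative.LatticeLawLoadBearing
import Summits.BirchSwinnertonDyer.BirchSwinnertonDyer.Theorems.ClassRecordThreeEulerHalvesAtThreeCartanTransportCoverReductionExists
import Summits.BirchSwinnertonDyer.BirchSwinnertonDyer.Theorems.ClassRecordThreeEulerHalvesAtThreeCartanSatOfNoFixed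
import Summits.BirchSwinnertonDyer.BirchSwinnertonDyer.Theorems.ClassRecordThreeEulerHalvesAtThreeCartanCuspNoFixedVector
import HarnessLib

/-!
# Disproof of `CartanOnePlaceDegreeLawAtThree` (NUM, crux item stmt-BirchSwinnertonDyer-24801) — findings

Disprover work file of unit `cdisprove-stmt-BirchSwinnertonDyer-24801-g0` (refuter; director-bsd explicit unit, kit 0; 2026-08-29).
Route decls `Theses.ClassRecordThree.CartanOnePlaceDegreeLawAtThree` and `Theses.KolyvaginRoadThree.CartanOnePlaceDegreeLawAtThree` are BOTH
`:= Theorems.CartanCorrespondence.CartanOnePlaceDegreeLawAtThree` (§0, `rfl`).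

VERDICT: **NO KILL.** Findings, indexed:

* §0 NON-ATTACKABILITY BY MODELS. NUM quantifies over a genuine curve `V∕ℚ` (`conductorNorm`, `analyticRank = 1` inside `ClassX11b`, Tamagawa number at `q`),
  Cartan-level curve data `CartanLevelCurveData D M C` (faithful Eichler order + hyperbolic fundamental domain) and TWO parametrisation data with
  `IsMinimalFor V`. None of these has a constructible instance in the tree (nor a junk one: `CartanLevelCurveData` pins a genuine quaternion order,
  `CoverReduction` is unique up to inner conjugation), so neither NUM nor any of the line stubs (all under the same binders) admits a model-theoretic
  refutation; the earlier refuter stamp (refuter-ns-regularity-refuter1-g23) reached the same conclusion. NUMERICS (HOME `tam3-p1/g24/CDEG3-RESULT.md`, exact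
  Manin-symbol degrees): `m₀ = 3·m_C` in 752∕752 (class, place) pairs satisfying NUM's hypotheses (principal-series places 78, incl. `q = 19, 37, 43`;
  `q = 2`: 505), saturation index `1` in 89∕89 PS cases — NUM looks TRUE.
* §1 LOAD-BEARING HYPOTHESES OF NUM (paper analysis; one near-miss stated in Lean with `sorry`, not closable here for the reason of §0):
  - `ClassX11b V 3 ∧ Surj V 3` (big image at 3): LOAD-BEARING — FALSE WITHOUT on paper: CDEG3 tag-x3 classes with a rational `3`-isogeny give ratio
    `m₀ ∕ m_C = 1` at `N = 36, 44, 92, 50, 108, 225, 550` (e.g. class 36a, `q = 2`, `M = 9`, `c₂ = 3`: `m_C = m₀ = 1`, both curves of genus `1`, the two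
    optimal curves `3`-isogenous). Near-miss `onePlaceLaw_false_without_bigImage` (§1).
  - `3 ∣ c_q(V)`: POSSIBLY UNNECESSARY for the truth of NUM — the 36 PS pairs of CDEG3 R2 split 18 + 18 between `c_q = 1` and `c_q = 3` and ALL obey
    `m₀ = 3m_C`; it is what makes NUM useful in (T3), not what makes it true (information for provers; no statement change proposed).
  - `analyticRank V = 1` (inside `ClassX11b`): plays no role in the mechanism (degrees of parametrisations); cannot be dropped in a Lean witness anyway.
  - `q ≠ 3`, `q ∈ C`, `¬ q³ ∣ N`: structural (tame cubic place of exponent `2`); `q = 2` is the EASY case (`W₂ = sgn`, cyclic `C₃`-cover).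
* §2 `-- Targets`: the stubs of the registered line `Lines/lattice.lean` v2 (and the un-keyed `Lines/charext.lean`). KERNEL FACTS LANDED (p731933,
  `Theorems/CartanOnePlaceDegreeLawAtThree/Negative/LatticeLawLoadBearing.lean`): in the finite-group LATTICE CONTRACT that the dictionary
  `CartanSaturatedDictionary.saturatedDictionary_of_coverFacts` consumes, (D4) `SaturationAtThree` and (D3) `DescentNonsplitAtThree` are LOAD-BEARING —
  the contract minus (D4) is FALSE at every PS place `q ≡ 1 (mod 3)`, `q ≥ 5` (the mod-3 line `X_M` of any Cartan torus lattice INVERTS the law), the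
  contract minus (D3) is FALSE at every `q ≠ 3` (`u_C := 3w_C`), the full contract implies the law (tree). So (A)+(M)+(P+T)+(D3) do NOT give NUM through the
  dictionary: a proof along `lattice` (or `charext`, same leaves) must prove (D4) at PS places; at cusp places (D4) is automatic
  (`CartanSupply.CuspNoFixed.noFixedVectorModThree_of_cusp`). (A) is a tree theorem. (M), (P+T) are print∕transport; no smell found in their constants
  (`|T_s| = (q−1)²`, `|T_η| = q²−1`, sheet orientation consistent with `witness_arith`). `charext`'s pure group-theory stub (EXT) `InvariantHomExtendsSL2` is
  TRUE as typed (inflation–restriction; `SL₂(𝔽_q)` perfect with trivial Schur multiplier for prime `q ≥ 7`, and `q % 3 = 1` forces `q ≥ 7`) — no kill.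
* §3 NATURAL STRENGTHENINGS REFUTED (kernel): «the law for EVERY integral form of `W_q`» (= contract without (D4)) and «the law for ANY torus-fixed `u_C`»
  (= contract without (D3)) — both false, see §2. «(F2b♮) ⟺ NUM» is a tree theorem (`CartanSatOfNoFixed.saturatedDictionary_iff_onePlaceLaw`), so NUM has no
  strictly weaker lattice-side reformulation to attack.
* §4 REGIMES NOT TESTED (kit 0 in this unit; dossier `tam3-p1/g26/NUM-LINES-AND-D1-DESIGN-g26.md` §5): `D > 1` (genuine Shimura curves), `#C ≥ 2` with a
  non-cubic type at another Cartan place (structurally harmless: every exponent-2 type has a one-dimensional `T_ns(p)`-fixed line, so `𝕃 ≅ W_q`-lattice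
  still), `q ≡ 1 (mod 9)` (first PS place `q = 19`: 3 pairs computed, consistent). A `kit` unit could extend CDEG3 there; nothing in the mechanism predicts failure.

## HANDOFF
Landed: p731933 (Negative/LatticeLawLoadBearing.lean: `latticeLaw_with_saturation`, `latticeLaw_false_without_descent`, `latticeLaw_false_without_saturation`,
`exists_invertedLaw_of_cartanTorusLattice`, `exists_invertedLaw_in_lattice`, `witness_arith`, `trace_eq_of_three_smul_mem`, `finrank_eq_of_three_smul_mem`).
Sorried here: `onePlaceLaw_false_without_bigImage` (paper witness 36a@2; needs `CartanLevelCurveData 1 9 {2}` + parametrisation data + conductor∕Tamagawa of 36a).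
Next regimes for a kit-enabled disprover: `D = 6, 10` Shimura-curve Cartan degrees; `q = 19, 37` more classes; a class with `#C = 2`.
-/

set_option linter.dupNamespace false
set_option autoImplicit false

noncomputable section

open scoped Classical

namespace Summit.BirchSwinnertonDyer.BirchSwinnertonDyer.Cruxes.CartanOnePlaceDegreeLawAtThree.Disproof

open Summit.BirchSwinnertonDyer.BirchSwinnertonDyer.Theorems
open WeierstrassCurve IsDedekindDomain NumberField Literature.NumberTheory.EllipticCurves
  Literature.NumberTheory.EllipticCurves.ModularForms
  Literature.NumberTheory.EllipticCurves.Rank1Residual Literature.NumberTheory.Automorphic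
  Summit.BirchSwinnertonDyer.Rank1Residual
  Summit.BirchSwinnertonDyer.BirchSwinnertonDyer.Theorems.CartanDegree
  Summit.BirchSwinnertonDyer.BirchSwinnertonDyer.Theorems.CartanTorusCubeCut

/-! ## §0 The crux decls are the Theorems decl (sanity) -/

example : Summit.BirchSwinnertonDyer.BirchSwinnertonDyer.Theses.ClassRecordThree.CartanOnePlaceDegreeLawAtThree =
    CartanCorrespondence.CartanOnePlaceDegreeLawAtThree := rfl

example : Summit.BirchSwinnertonDyer.BirchSwinnertonDyer.Theses.KolyvaginRoadThree.CartanOnePlaceDegreeLawAtThree =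
    CartanCorrespondence.CartanOnePlaceDegreeLawAtThree := rfl

/-! ## §1 Load-bearing hypotheses of NUM: the big-image clause (near-miss) -/

/-- NUM with the big-image hypotheses `ClassX11b V 3 → Surj V 3 →` DROPPED (everything else verbatim). -/
@[conjecture]
def OnePlaceLawWithoutBigImage : Prop :=
    ∀ (V : WeierstrassCurve ℚ) [V.IsElliptic] [V.IsGloballyMinimal],
      ∀ (N D M : ℕ) (C : Finset ℕ) (q : ℕ) [Fact q.Prime]
        (X : CartanLevelCurveData D M C) (W₁ : WeierstrassCurve ℚ) [W₁.IsElliptic] (Q : CartanParametrizationData X W₁)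
        (X' : CartanLevelCurveData D (M * q ^ 2) (C.erase q)) (W₂ : WeierstrassCurve ℚ) [W₂.IsElliptic]
        (Q' : CartanParametrizationData X' W₂),
        V.conductorNorm ℤ = N → D * M * ∏ p ∈ C, p ^ 2 = N → q ∈ C → q ≠ 3 → ¬ q ^ 3 ∣ N →
        3 ∣ (V.baseChange ℚ_[q]).localTamagawaNumber ℤ_[q] →
        Q.IsMinimalFor V → Q'.IsMinimalFor V →
        padicValNat 3 Q'.deg = padicValNat 3 Q.deg + 1

/-- NEAR-MISS (paper-false; NOT closable in the tree, see §0 of the module doc) — **the big-image clause of NUM is load-bearing.** Paper witness: Cremona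
class 36a at its Cartan place `q = 2` (`N = 36 = 9·2²`, `D = 1`, `M = 9`, `C = {2}`, Kodaira IV*, `c₂ = 3`): `X₀(36)` and `X_{(1,9;{2})} = (Γ₀(9) ∩ Γ_ns(2))∖ℍ*`
both have genus `1`, the class-minimal degrees are `m₀ = m_C = 1` (CDEG3 R1∕R2 row `x3 36 2 … CONTRADICTS`, HOME `tam3-p1/g24/CDEG3-full-j328461.tsv`; the two
optimal curves are `3`-isogenous, dual isogenies of determinant `(−3,−3)` per CDEG3 §mechanism), so `ord₃ m₀ = 0 ≠ ord₃ m_C + 1`. The class has a rational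
`3`-isogeny, violating `Irr V 3` ∕ `Surj V 3`. OBSTRUCTION to a kernel proof: no term of `CartanLevelCurveData 1 9 {2}` (needs `IsHypFundamentalDomain` for
`Γ₀(9) ∩ Γ_ns(2)`), no `CartanParametrizationData` terms, no evaluation of `conductorNorm`∕`localTamagawaNumber` for 36a in the tree. [folklore] -/
theorem onePlaceLaw_false_without_bigImage : ¬ OnePlaceLawWithoutBigImage := by
  sorry

/-! ## §2 Targets — line `lattice` v2 (`stub_printInputsCartanCover`, `stub_splitSideSheetAtThree`, `stub_descentNonsplitAtThree`, `stub_saturationAtThree`) -/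

/-- (A) of `stub_printInputsCartanCover` is a tree THEOREM (not a target). -/
example : CartanCover.CoverReductionExists := CartanTransport.Cover.coverReductionExists

/-- (D3) `stub_descentNonsplitAtThree` is LOAD-BEARING in the dictionary's contract (kernel, p731933): the contract minus «`u_C ∉ 3Λ`» is false. -/
example := @CartanOnePlaceDegreeLawAtThreeNegative.latticeLaw_false_without_descent

/-- (D4) `stub_saturationAtThree` is LOAD-BEARING in the dictionary's contract (kernel, p731933): the contract minus «`(Λ∕3Λ)^G = 0`» is false — at every
PS place `q ≡ 1 (mod 3)`, `q ≥ 5`, the other `ℤ`-form `K = X_M` of any Cartan torus lattice inverts the law (`exists_invertedLaw_of_cartanTorusLattice`). -/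
example := @CartanOnePlaceDegreeLawAtThreeNegative.latticeLaw_false_without_saturation

/-- … whereas the FULL contract implies the law (tree; recorded in the Negative file for contrast). -/
example := @CartanOnePlaceDegreeLawAtThreeNegative.latticeLaw_with_saturation

/-- PROVED — **THE GENERAL COUNTER-MODEL FAMILY behind (D4)'s load-bearing status** (from the Negative file): for every PS place `q ≡ 1 (mod 3)`, `q ≥ 5`,
and every Cartan torus lattice with torus generators, there are data satisfying (M)+(P+T)+(D3) in the abstract with `u_C ≠ 0` fixed modulo `3` and the
INVERTED law `ord₃ degX0 + 1 = ord₃ degC`. [folklore] -/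
theorem invertedLaw_family {q : ℕ} [Fact q.Prime] (hq5 : 5 ≤ q) (h1 : q % 3 = 1) (𝓛 : CartanTorusLattice q)
    (wS wC : Fin 𝓛.d → ℤ) (hS : 𝓛.IsSplitFixed wS) (hC : 𝓛.IsNonsplitFixed wC)
    (hSgen : ∀ v, 𝓛.IsSplitFixed v → ∃ m : ℤ, v = m • wS) (hCgen : ∀ v, 𝓛.IsNonsplitFixed v → ∃ m : ℤ, v = m • wC)
    (hwS : wS ≠ 0) (hwC : wC ≠ 0) :
    ∃ (ρ' : Representation ℤ (G q) (Fin 𝓛.d → ℤ)) (uC : Fin 𝓛.d → ℤ) (degX0 degC : ℕ),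
      (∀ g, LinearMap.trace ℤ (Fin 𝓛.d → ℤ) (ρ' g) = cubicNewvectorChar q g) ∧
      (uC ≠ 0 ∧ ∀ g, ∃ w : Fin 𝓛.d → ℤ, ρ' g uC - uC = (3 : ℤ) • w) ∧ (¬ ∃ v : Fin 𝓛.d → ℤ, uC = (3 : ℤ) • v) ∧
      0 < degX0 ∧ 0 < degC ∧ padicValNat 3 degX0 + 1 = padicValNat 3 degC := by
  obtain ⟨ρ', -, -, uC, -, degX0, degC, htr, -, -, -, -, -, -, h3C, hfix, -, hX0, hC0, -, -, hlaw⟩ :=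
    CartanOnePlaceDegreeLawAtThreeNegative.exists_invertedLaw_of_cartanTorusLattice hq5 h1 𝓛 wS wC hS hC hSgen hCgen hwS hwC
  exact ⟨ρ', uC, degX0, degC, htr, hfix, h3C, hX0, hC0, hlaw⟩

/-- PROVED — at CUSPIDAL places `q ≡ 2 (mod 3)` the clause (D4) is automatic for ANY integral representation with character `cubicNewvectorChar q`
(tree, p710975): the unsaturated contract and the full contract coincide there, so the counter-models of (D4) live exactly at PS places. [folklore] -/
example {q : ℕ} [Fact q.Prime] (h2 : q % 3 = 2) (𝓛 : CartanTorusLattice q) (v : Fin 𝓛.d → ℤ)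
    (hv : ∀ g, ∃ w : Fin 𝓛.d → ℤ, 𝓛.ρ g v - v = (3 : ℤ) • w) : ∃ w : Fin 𝓛.d → ℤ, v = (3 : ℤ) • w :=
  CartanSupply.CuspNoFixed.cartanTorusLattice_noFixed_redundant h2 𝓛 v hv

/-! ## §3 (F2b♮) ⟺ NUM is a tree theorem: no weaker lattice-side reformulation of NUM exists to attack -/

example : CartanSaturatedDictionary.CartanHomLatticeSaturatedDictionaryAtThree ↔ CartanCorrespondence.CartanOnePlaceDegreeLawAtThree :=
  CartanSatOfNoFixed.saturatedDictionary_iff_onePlaceLaw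

end Summit.BirchSwinnertonDyer.BirchSwinnertonDyer.Cruxes.CartanOnePlaceDegreeLawAtThree.Disproof
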